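import Summits.NavierStokesRegularity.FluidComputer.PalasekTowerGermHostDecoratedSlot
import Summits.NavierStokesRegularity.FluidComputer.PalasekTowerGermHostRate
import Summits.NavierStokesRegularity.FluidComputer.PalasekTowerTinyBlobStrainExplicit

/-!
# The germ host, XXX: LARGE carriers in the STRICT slot, with numeric constants — `decoratedBlob b a + farPusher`

Cell `ns-blowup`, seat `ns-blowup-ecbridge-3` (g5); GROUP C «BRIDGE SUPPORT» of the route
`PalasekTowerBreakdown` (crux `EpisodeBaseG`, item stmt-NavierStokesRegularity-19179, R2; line `slot` v5). Sequel of
`PalasekTowerGermHostDecoratedSlot.lean` (g3: the decorated blobs `decoratedBlob b a` — flat even carriers of EVERY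
size `b > 0` — fill the WEAK slot only, anchor value `0`, decoration scale `a ≤ strainConst/512` a `Classical.choose`),
`PalasekTowerGermHostRate.lean` (`rate_add_farPusher_ge`: the far pusher gives EVERY flat even carrier supported in
`B̄(0, ρ₁)`, `ρ₁ < 15/4`, the numeric rate `Y₀³/200000`) and `PalasekTowerTinyBlobStrainExplicit.lean` (the explicit
strain point `x₁`). LABEL: E–C typing (KERNEL, proofs only). WHAT THIS IS NOT: not Navier–Stokes evidence — level-`0`
bookkeeping of PRESCRIBED composite profiles at one instant; the carriers are viscous flat blobs and the pusher a slow
swirl, so the episode of these designs is as negative as every kernel host of record; nothing about any flow after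
`τ₀`, `FirstEpisodeD`, `RungG 1` or blow-up.

## What

* §1 the decoration's strain floor at the EXPLICIT point `p + a x₁`: `A₀ ≤ ‖D(decoratedBlob b a)(p + a x₁)‖` for
  `0 < a ≤ 11/1296` (`strain_decoratedBlob_explicit`; `½ · Y₀ · 352/(81a) ≥ 256 Y₀`), hence the weak slot with NO
  `Classical.choose`: `levelZeroDataWeak_decoratedBlob_explicit` (every `b > 0`);
* §2 **`levelZeroData_decorated_add_farPusher`**: for `0 < b ≤ 13/16` and `0 < a ≤ 11/1296` the composite
  `decoratedBlob b a + farPusher` fills the STRICT slot `LevelZeroData · 7`, with the numeric anchor value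
  `≥ Y₀³/200000` on its argmax `{0}` (`anchor_decorated_add_farPusher_ge`) — a strict carrier of radius `2b + 2` up to
  `29/8` (`Re ∼ Y₀(2b + 2) ≲ 5·10³` at the slot's unit viscosity), usable as `U₁` in every companion/amplifier rule
  (`LevelZeroData.add_translate`, `…add_translate_curl`) with `m = Y₀³/200000`; host preparation and the crux
  reduction follow (`hostPreparationD_strictLarge`, `episodeBaseG_of_firstEpisodeD_strictLarge`).

References: S. Palasek, arXiv:2605.13827 §3.3 [cite: Palasek2026ElementaryModel, §3.3]; A. J. Majda, A. L. Bertozzi,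
*Vorticity and Incompressible Flow* (CUP 2002), §1.8 Prop. 1.16 [cite: MajdaBertozziCUP2002, §1.8 Prop. 1.16].
-/

noncomputable section

namespace Summit.NavierStokesRegularity.FluidComputer.PalasekTowerClayBridge.Germ

open Set Function Filter Topology InnerProductSpace Metric MeasureTheory Real
open scoped Topology ContDiff RealInnerProductSpace Laplacian

open Literature.Analysis.FluidPDE TinyBlob

variable {a b : ℝ}

/-! ## §1 The decoration's strain floor at the explicit point -/

/-- `Y₀ · 352/(81a) ≤ ‖DU_a(a x₁)‖` (the explicit strain point of the unit blob, scaled). [folklore] -/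
theorem le_norm_fderiv_tinyProfile_strainPt₁ (ha : 0 < a) :
    TowerRates.wide.Y 0 * (352 / 81 / a) ≤ ‖fderiv ℝ (tinyProfile a) (a • strainPt₁)‖ := by
  rw [fderiv_tinyProfile, norm_smul, Real.norm_eq_abs, abs_of_pos (TowerRates.Y_pos _ _)]
  exact mul_le_mul_of_nonneg_left (le_norm_fderiv_tinyBlob_strainPt₁ ha) (TowerRates.Y_pos _ _).le

/-- **The strain floor of the decorated blob at the EXPLICIT point `p + a x₁`** for `0 < a ≤ 11/1296`
(near `p` the profile is `½ U_a(· − p)`; `½ · Y₀ · 352/(81a) ≥ 256 Y₀ = A₀`). [cite: Palasek2026ElementaryModel, §3.3] -/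
theorem strain_decoratedBlob_explicit (hb : 0 < b) (ha : 0 < a) (h : a ≤ 11 / 1296) :
    TowerRates.wide.A 0 ≤ ‖fderiv ℝ (decoratedBlob b a) (decorCenter b + a • strainPt₁)‖ := by
  have h5 : a ≤ 5 / 256 := h.trans (by norm_num)
  set y₁ := decorCenter b + a • strainPt₁ with hy₁
  have hn : ‖a • strainPt₁‖ = 2 / 3 * a := norm_smul_strainPt₁ ha.le
  have hev : decoratedBlob b a =ᶠ[𝓝 y₁] fun z => (1 / 2 : ℝ) • tinyProfile a (z - decorCenter b) := by
    have hopen : IsOpen {z : EuclideanSpace ℝ (Fin 3) | ‖z - decorCenter b‖ < 1 / 2} :=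
      isOpen_lt (continuous_id.sub continuous_const).norm continuous_const
    have hmem : y₁ ∈ {z : EuclideanSpace ℝ (Fin 3) | ‖z - decorCenter b‖ < 1 / 2} := by
      simp only [mem_setOf_eq, hy₁, add_sub_cancel_left, hn]; linarith
    filter_upwards [hopen.mem_nhds hmem] with z hz
    exact decoratedBlob_of_near_plus hb ha h5 (le_of_lt hz)
  rw [hev.fderiv_eq, fderiv_fun_const_smul ((contDiff_tinyProfile_comp_sub a _).differentiable
    (by simp) y₁), fderiv_tinyProfile_comp_sub, hy₁, add_sub_cancel_left, norm_smul, Real.norm_eq_abs,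
    abs_of_pos (by norm_num : (0 : ℝ) < 1 / 2), Host.wide_A_zero_eq, Host.wide_N_zero]
  have hY := TowerRates.Y_pos TowerRates.wide 0
  have h1 := le_norm_fderiv_tinyProfile_strainPt₁ ha
  have h2 : (512 : ℝ) ≤ 352 / 81 / a := by
    rw [le_div_iff₀ ha]; linarith
  nlinarith [mul_le_mul_of_nonneg_left h2 hY.le]

/-- **The weak slot with NO `Classical.choose`**: `LevelZeroDataWeak (decoratedBlob b a) (2b + 2)` for every
`b > 0` and every numeric `0 < a ≤ 11/1296`. [cite: Palasek2026ElementaryModel, §3.3] -/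
theorem levelZeroDataWeak_decoratedBlob_explicit (hb : 0 < b) (ha : 0 < a) (h : a ≤ 11 / 1296) :
    LevelZeroDataWeak (decoratedBlob b a) (2 * b + 2) := by
  have h5 : a ≤ 5 / 256 := h.trans (by norm_num)
  exact
  { smooth := contDiff_decoratedBlob b a
    support := tsupport_decoratedBlob_subset hb ha h5
    divFree := isDivFree_decoratedBlob hb.ne' ha.ne'
    ceiling := fun y => (norm_decoratedBlob_le hb ha h5 y).1
    floor := ⟨0, by simp; linarith, by rw [decoratedBlob_zero hb ha h5, norm_tinyProfile_zero]⟩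
    strain := ⟨decorCenter b + a • strainPt₁, by
      have := norm_add_le (decorCenter b) (a • strainPt₁)
      rw [norm_decorCenter hb.le, norm_smul_strainPt₁ ha.le] at this
      linarith, strain_decoratedBlob_explicit hb ha h⟩
    core := core_decoratedBlob hb ha h5
    anchor := anchor_decoratedBlob hb ha h5 }

/-! ## §2 The decorated blob with the far pusher: a LARGE strict carrier -/

section Large

variable (hb : 0 < b) (hb' : b ≤ 13 / 16) (ha : 0 < a) (h : a ≤ 11 / 1296)
include hb hb' ha h

omit hb hb' ha in
/-- `a ≤ 5/256`. [folklore] -/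
theorem scale_le_of_le : a ≤ 5 / 256 := h.trans (by norm_num)

omit hb hb' ha h in
/-- Near the origin (`‖x‖ < 15/4`) the composite is the carrier. [folklore] -/
theorem decorated_add_farPusher_of_norm_lt {x : EuclideanSpace ℝ (Fin 3)} (hx : ‖x‖ < 15 / 4) :
    (decoratedBlob b a + farPusher) x = decoratedBlob b a x := by
  rw [Pi.add_apply, farPusher_eq_zero_of_norm_lt hx, add_zero]

omit hb' in
/-- Beyond the carrier (`‖x‖ > 2b + 2`) the composite is the pusher. [folklore] -/
theorem decorated_add_farPusher_of_lt {x : EuclideanSpace ℝ (Fin 3)} (hx : 2 * b + 2 < ‖x‖) :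
    (decoratedBlob b a + farPusher) x = farPusher x := by
  rw [Pi.add_apply, decoratedBlob_eq_zero_of_lt hb ha (scale_le_of_le h) hx, zero_add]

/-- **Speed ceiling** `‖U‖ ≤ Y₀`. [folklore] -/
theorem norm_decorated_add_farPusher_le (x : EuclideanSpace ℝ (Fin 3)) :
    ‖(decoratedBlob b a + farPusher) x‖ ≤ TowerRates.wide.Y 0 := by
  by_cases hx : ‖x‖ < 15 / 4
  · rw [decorated_add_farPusher_of_norm_lt hx]
    exact (norm_decoratedBlob_le hb ha (scale_le_of_le h) x).1
  · push Not at hx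
    rw [decorated_add_farPusher_of_lt hb ha h (by linarith)]
    exact (norm_farPusher_lt x).le

/-- **The argmax is the origin.** [folklore] -/
theorem eq_zero_of_norm_decorated_add_farPusher_eq {x : EuclideanSpace ℝ (Fin 3)}
    (hx : ‖(decoratedBlob b a + farPusher) x‖ = TowerRates.wide.Y 0) : x = 0 := by
  by_cases hn : ‖x‖ < 15 / 4
  · rw [decorated_add_farPusher_of_norm_lt hn] at hx
    exact (norm_decoratedBlob_le hb ha (scale_le_of_le h) x).2 hx
  · push Not at hn
    rw [decorated_add_farPusher_of_lt hb ha h (by linarith)] at hx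
    exact absurd hx (norm_farPusher_lt x).ne

omit hb hb' ha h in
/-- The decorated blob is even about `0`. [folklore] -/
theorem isEvenAbout_decoratedBlob : IsEvenAbout 0 (decoratedBlob b a) := fun x => by
  show decoratedBlob b a (0 + (0 - x)) = decoratedBlob b a x
  rw [zero_add, zero_sub, decoratedBlob_neg]

/-- **THE NUMERIC ANCHOR VALUE AT THE ORIGIN**: `Y₀³/200000 ≤ ⟪U(0), accel ν U 0⟫` at every `ν`
(`rate_add_farPusher_ge` — the carrier is flat, even, supported in `B̄(0, 2b + 2)`, `2b + 2 < 15/4`).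
[cite: MajdaBertozziCUP2002, §1.8 Prop. 1.16] -/
theorem rate_decorated_add_farPusher_ge (ν : ℝ) :
    TowerRates.wide.Y 0 ^ 3 / 200000 ≤
      ⟪(decoratedBlob b a + farPusher) 0, accel ν (decoratedBlob b a + farPusher) 0⟫ := by
  have h5 := scale_le_of_le h
  have h0 : decoratedBlob b a 0 = TowerRates.wide.Y 0 • e₃ := by
    rw [decoratedBlob_zero hb ha h5, tinyProfile_zero]
  exact rate_add_farPusher_ge (contDiff_decoratedBlob b a) (tsupport_decoratedBlob_subset hb ha h5) (by linarith)
    (isDivFree_decoratedBlob hb.ne' ha.ne') (isEvenAbout_decoratedBlob)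
    (laplacian_decoratedBlob_zero hb ha h5) h0 ν

/-- **The anchor test with the NUMERIC rate on the argmax.** [cite: Palasek2026ElementaryModel, §3.3] -/
theorem anchor_decorated_add_farPusher_ge (x : EuclideanSpace ℝ (Fin 3))
    (hx : ‖(decoratedBlob b a + farPusher) x‖ = TowerRates.wide.Y 0) :
    TowerRates.wide.Y 0 ^ 3 / 200000 ≤
      ⟪(decoratedBlob b a + farPusher) x, accel 1 (decoratedBlob b a + farPusher) x⟫ := by
  obtain rfl := eq_zero_of_norm_decorated_add_farPusher_eq hb hb' ha h hx
  exact rate_decorated_add_farPusher_ge hb hb' ha h 1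

/-- `tsupport U ⊆ B̄(0, 7)`. [folklore] -/
theorem tsupport_decorated_add_farPusher_subset :
    tsupport (decoratedBlob b a + farPusher) ⊆ closedBall (0 : EuclideanSpace ℝ (Fin 3)) 7 := by
  refine closure_minimal (fun x hx => ?_) isClosed_closedBall
  rw [mem_closedBall, dist_zero_right]
  by_contra hfar
  push Not at hfar
  refine hx ?_
  rw [decorated_add_farPusher_of_lt hb ha h (by linarith)]
  refine farPusher_eq_zero fun hmem => ?_
  have h1 := (geometry_of_mem_tsupport hmem).1
  have : ‖x‖ ≤ ‖x - pusherCenter‖ + ‖pusherCenter‖ := norm_le_norm_sub_add x pusherCenter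
  rw [norm_pusherCenter] at this
  linarith

omit hb' h in
/-- `U` is divergence free. [folklore] -/
theorem isDivFree_decorated_add_farPusher : VectorCalculus.IsDivFree (decoratedBlob b a + farPusher) := by
  intro x
  have h1 := isDivFree_decoratedBlob hb.ne' ha.ne' x
  have h2 := isDivFree_farPusher x
  simp only [VectorCalculus.divergence] at h1 h2 ⊢
  rw [fderiv_add ((contDiff_decoratedBlob b a).differentiable (by simp) x)
    (contDiff_farPusher.differentiable (by simp) x)]
  push_cast
  rw [map_add, h1, h2, add_zero]

omit hb hb' ha h in
/-- Near the origin the Jacobian of `U` is the carrier's. [folklore] -/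
theorem fderiv_decorated_add_farPusher_of_norm_lt {x : EuclideanSpace ℝ (Fin 3)} (hx : ‖x‖ < 15 / 4) :
    fderiv ℝ (decoratedBlob b a + farPusher) x = fderiv ℝ (decoratedBlob b a) x := by
  have hev : (decoratedBlob b a + farPusher) =ᶠ[𝓝 x] decoratedBlob b a := by
    have hopen : IsOpen {y : EuclideanSpace ℝ (Fin 3) | ‖y‖ < 15 / 4} := isOpen_lt continuous_norm continuous_const
    filter_upwards [hopen.mem_nhds hx] with y hy
    exact decorated_add_farPusher_of_norm_lt hy
  exact hev.fderiv_eq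

/-- **The strain floor** is the decoration's. [folklore] -/
theorem strain_decorated_add_farPusher :
    ∃ x : EuclideanSpace ℝ (Fin 3), ‖x‖ ≤ 7 ∧
      TowerRates.wide.A 0 ≤ ‖fderiv ℝ (decoratedBlob b a + farPusher) x‖ := by
  have hn : ‖decorCenter b + a • strainPt₁‖ ≤ 2 * b + 1 + 2 / 3 * a := by
    have := norm_add_le (decorCenter b) (a • strainPt₁)
    rwa [norm_decorCenter hb.le, norm_smul_strainPt₁ ha.le] at this
  refine ⟨decorCenter b + a • strainPt₁, by linarith, ?_⟩
  rw [fderiv_decorated_add_farPusher_of_norm_lt (by linarith)]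
  exact strain_decoratedBlob_explicit hb ha h

/-- **The core loop** is the decoration's (the pusher vanishes along it). [folklore] -/
theorem core_decorated_add_farPusher :
    ∃ (x : EuclideanSpace ℝ (Fin 3)) (γ : ℝ → EuclideanSpace ℝ (Fin 3)),
      ‖x‖ ≤ 7 ∧ ContDiff ℝ 1 γ ∧ γ 0 = γ 1 ∧
        (∀ s ∈ Icc (0 : ℝ) 1, γ s ∈ closedBall x (1 / TowerRates.wide.N 0)) ∧
        (∀ s ∈ Icc (0 : ℝ) 1, ‖deriv γ s‖ ≤ 8 * Real.pi / TowerRates.wide.N 0) ∧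
        TowerRates.wide.N 0 ^ (TowerRates.wide.β - 2) ≤ circulation (decoratedBlob b a + farPusher) γ := by
  obtain ⟨x, γ, hx, hγ, h01, hball, hvel, hcirc⟩ := core_decoratedBlob hb ha (scale_le_of_le h)
  refine ⟨x, γ, by linarith, hγ, h01, hball, hvel, ?_⟩
  have hc : circulation (decoratedBlob b a + farPusher) γ = circulation (decoratedBlob b a) γ := by
    unfold circulation
    refine intervalIntegral.integral_congr fun s hs => ?_
    rw [uIcc_of_le zero_le_one] at hs
    have hs' : ‖γ s‖ < 15 / 4 := by
      have hbs := hball s hs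
      rw [mem_closedBall, dist_eq_norm, Host.wide_N_zero] at hbs
      have : ‖γ s‖ ≤ ‖γ s - x‖ + ‖x‖ := norm_le_norm_sub_add (γ s) x
      linarith
    simp only [decorated_add_farPusher_of_norm_lt hs']
  rw [hc]
  exact hcirc

/-- **LARGE CARRIERS IN THE STRICT SLOT, NUMERIC**: `LevelZeroData (decoratedBlob b a + farPusher) 7` for
`0 < b ≤ 13/16`, `0 < a ≤ 11/1296`. [cite: Palasek2026ElementaryModel, §3.3] -/
theorem levelZeroData_decorated_add_farPusher : LevelZeroData (decoratedBlob b a + farPusher) 7 where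
  smooth := (contDiff_decoratedBlob b a).add contDiff_farPusher
  support := tsupport_decorated_add_farPusher_subset hb hb' ha h
  divFree := isDivFree_decorated_add_farPusher hb ha
  ceiling := norm_decorated_add_farPusher_le hb hb' ha h
  floor := ⟨0, by simp, by
    rw [decorated_add_farPusher_of_norm_lt (by simp), decoratedBlob_zero hb ha
      (scale_le_of_le h), norm_tinyProfile_zero]⟩
  strain := strain_decorated_add_farPusher hb hb' ha h
  core := core_decorated_add_farPusher hb hb' ha h
  anchor x hx := lt_of_lt_of_le (by have := Host.wide_Y_zero_pos; positivity)
    (anchor_decorated_add_farPusher_ge hb hb' ha h x hx)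

/-- **Host preparation for the large strict carriers**, every push `c₄ ∈ (0, 1]`. [cite: Palasek2026ElementaryModel, §3.3] -/
theorem hostPreparationD_strictLarge {c₄ : ℝ} (hc₄ : 0 < c₄) (hc₄' : c₄ ≤ 1) :
    HostPreparationD (HostClass.exact
      ((levelZeroData_decorated_add_farPusher hb hb' ha h).schedule c₄ hc₄ hc₄')) :=
  (levelZeroData_decorated_add_farPusher hb hb' ha h).hostPreparationD_exact hc₄ hc₄'

/-- **… and the crux for these designs is their episode.** [cite: Palasek2026ElementaryModel, §4] -/
theorem episodeBaseG_of_firstEpisodeD_strictLarge {c₄ : ℝ} (hc₄ : 0 < c₄) (hc₄' : c₄ ≤ 1)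
    (hF : FirstEpisodeD (HostClass.exact
      ((levelZeroData_decorated_add_farPusher hb hb' ha h).schedule c₄ hc₄ hc₄'))) : EpisodeBaseG :=
  (levelZeroData_decorated_add_farPusher hb hb' ha h).episodeBaseG_of_firstEpisodeD hc₄ hc₄' hF

end Large

end Summit.NavierStokesRegularity.FluidComputer.PalasekTowerClayBridge.Germ

end
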